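import Summits.MatrixMultiplication.OmegaCensus.DihedralLikeModelIso
import Summits.MatrixMultiplication.OmegaCensus.DicyclicLawQuotientCyclic
import Summits.MatrixMultiplication.OmegaCensus.DicyclicLift
import Summits.MatrixMultiplication.OmegaCensus.DihedralLawModOneSmallExponent
import HarnessLib

/-!
# The dicyclic-type law classification as one theorem: attained ⟺ `A/⟨c₀⟩` cyclic

ω-census, family (b3).  Framing: lottery ticket; floor = certified bounds/negative ranges.

**Theorem (`dicyclic_type_mod_one_law_iff`).** Let `G` have a dihedral-like presentation `ρ, τ : A → G` over a finite abelian
group `A` with `τa τb = ρ(c₀ + b − a)`, **`c₀ ≠ 0`**, `|A| ≡ 1 (mod 3)`, `|A| ≥ 14`.  Then `G` has a TPP triple attaining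
`3|S||T||U| + 8 = 8|A|` **if and only if** `A = ⟨g⟩ ∪ (c₀ + ⟨g⟩)` for some `g` (i.e. `A/⟨c₀⟩` is cyclic).
* ⟹ is `quot_cyclic_of_mod_one_law_of_c0_ne_zero` (`DicyclicLawQuotientCyclic.lean`).
* ⟸ (this file): `G ≃* DihedralLikeGroup A c₀` (`equivOfPresentation`: the model is the universal realisation of the
  presentation); if `c₀ ∈ ⟨g⟩` then `A` is cyclic of even order `N = 2m`, `A ≃+ ℤ_N` with `c₀ ↦ m` (the unique involution),
  so `G ≃* G(ℤ_{2m}, m) ≃* Q_{4m}` and `quaternion_volume_ge_law` supplies the triple; if `c₀ ∉ ⟨g⟩` then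
  `(i, j) ↦ i c₀ + j g` is an isomorphism `ℤ₂ × ℤ_m ≃+ A` (`m = N/2 = ord g`) with `(1,0) ↦ c₀`, so
  `G ≃* G(ℤ₂ × ℤ_m, (1,0)) = ℤ_m ⋊ ℤ₄` and `z2zn_mod_one_law_attained` supplies it.  Transport: `DihedralLikeGroup.congr`,
  `exists_tpp_volume_of_mulEquiv` (`DihedralLikeModelIso.lean`).
-/

namespace Summit.MatrixMultiplication.OmegaCensus

open Literature.Combinatorics.Additive Finset

namespace DihedralLikeGroup

variable {A : Type} [AddCommGroup A] {c₀ : A} [Fact (c₀ + c₀ = 0)] {G : Type*} [Group G]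
  {ρ τ : A → G}

/-- The canonical map from the model to any group carrying the presentation, as a function. [folklore] -/
def toPresentationFun (ρ τ : A → G) : DihedralLikeGroup A c₀ → G
  | rho a => ρ a
  | tau a => τ a

/-- **The model is universal**: a dihedral-like presentation `ρ, τ : A → G` (relations with parameter `c₀`, `ρ, τ`
injective with disjoint images covering `G`) identifies `G` with `DihedralLikeGroup A c₀`. [folklore] -/
noncomputable def equivOfPresentation (hρρ : ∀ a b, ρ a * ρ b = ρ (a + b))
    (hρτ : ∀ a b, ρ a * τ b = τ (b - a)) (hτρ : ∀ a b, τ a * ρ b = τ (a + b))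
    (hττ : ∀ a b, τ a * τ b = ρ (c₀ + b - a)) (hρ : Function.Injective ρ) (hτ : Function.Injective τ)
    (hne : ∀ a b, ρ a ≠ τ b) (hsurj : ∀ g, (∃ a, ρ a = g) ∨ (∃ a, τ a = g)) :
    DihedralLikeGroup A c₀ ≃* G :=
  MulEquiv.ofBijective
    (MonoidHom.mk' (toPresentationFun (c₀ := c₀) ρ τ) (by
      rintro (a | a) (b | b)
      · exact (hρρ a b).symm
      · exact (hρτ a b).symm
      · exact (hτρ a b).symm
      · exact (hττ a b).symm))
    (by
      constructor
      · rintro (a | a) (b | b) h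
        · exact congrArg rho (hρ h)
        · exact absurd h (hne a b)
        · exact absurd h.symm (hne b a)
        · exact congrArg tau (hτ h)
      · intro g
        rcases hsurj g with ⟨a, rfl⟩ | ⟨a, rfl⟩
        · exact ⟨rho a, rfl⟩
        · exact ⟨tau a, rfl⟩)

end DihedralLikeGroup

/-! ## `Q_{4m}` is the model `G(ℤ_{2m}, m)` -/

section Quaternion

variable {m : ℕ}

/-- `m + m = 0` in `ZMod (2m)`. [folklore] -/
instance fact_half_add_half (m : ℕ) : Fact (((m : ZMod (2 * m)) + (m : ZMod (2 * m))) = 0) :=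
  ⟨by rw [← Nat.cast_add, ← two_mul, ZMod.natCast_self]⟩

/-- `Q_{4m} = QuaternionGroup m ≃* G(ℤ_{2m}, m)` (the presentation `a i ↦ ρ i`, `xa i ↦ τ i`). [folklore] -/
noncomputable def quaternionEquivModel (m : ℕ) : DihedralLikeGroup (ZMod (2 * m)) (m : ZMod (2 * m)) ≃* QuaternionGroup m :=
  DihedralLikeGroup.equivOfPresentation (ρ := QuaternionGroup.a) (τ := QuaternionGroup.xa) QuaternionGroup.a_mul_a
    QuaternionGroup.a_mul_xa QuaternionGroup.xa_mul_a QuaternionGroup.xa_mul_xa (fun _ _ h => by cases h; rfl)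
    (fun _ _ h => by cases h; rfl) (fun _ _ h => by cases h) (fun g => by
      cases g with
      | a i => exact Or.inl ⟨i, rfl⟩
      | xa i => exact Or.inr ⟨i, rfl⟩)

/-- The mod-one law in the model `G(ℤ_{2m}, m)` (`2m ≡ 1 (mod 3)`, `m ≥ 3`), from `quaternion_volume_ge_law`. [folklore] -/
theorem quaternionModel_mod_one_law_attained [NeZero m] (hm : 3 ≤ m) (hmod : m % 3 = 2) :
    ∃ S T U : Finset (DihedralLikeGroup (ZMod (2 * m)) (m : ZMod (2 * m))), TripleProductProperty S T U ∧
      3 * (S.card * T.card * U.card) + 8 = 8 * Fintype.card (ZMod (2 * m)) := by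
  obtain ⟨S, T, U, h, hV⟩ := quaternion_volume_ge_law (n := m) hm
  obtain ⟨S', T', U', h', hV'⟩ := exists_tpp_volume_of_mulEquiv (quaternionEquivModel m).symm ⟨S, T, U, h, rfl⟩
  refine ⟨S', T', U', h', ?_⟩
  rw [hV', hV, ZMod.card]
  omega

end Quaternion


/-! ## Structure of `(A, c₀)` when `A = ⟨g⟩ ∪ (c₀ + ⟨g⟩)` -/

section Structure

variable {A : Type} [AddCommGroup A] [Fintype A] [DecidableEq A] {c₀ : A}

/-- In `ZMod (2m)` the only non-zero solution of `x + x = 0` is `x = m`. [folklore] -/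
theorem ZMod.eq_half_of_add_self {m : ℕ} [NeZero m] {x : ZMod (2 * m)} (hx : x ≠ 0) (h2 : x + x = 0) :
    x = (m : ZMod (2 * m)) := by
  haveI : NeZero (2 * m) := ⟨by have := NeZero.ne m; omega⟩
  have hv : (x + x).val = 0 := by rw [h2, ZMod.val_zero]
  rw [ZMod.val_add] at hv
  have hlt := ZMod.val_lt x
  have hne : x.val ≠ 0 := fun h0 => hx ((ZMod.val_eq_zero x).1 h0)
  have hdvd : 2 * m ∣ x.val + x.val := Nat.dvd_of_mod_eq_zero hv
  obtain ⟨k, hk⟩ := hdvd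
  have hk1 : k = 1 := by
    rcases k with _ | _ | k
    · omega
    · rfl
    · nlinarith
  subst hk1
  have hval : x.val = m := by omega
  rw [← ZMod.natCast_zmod_val x, hval]

omit [DecidableEq A] in
/-- **Cyclic case.** If `A = ⟨g⟩` has even order `2m` and `c₀ ≠ 0 = 2c₀`, then `A ≃+ ℤ_{2m}` with `c₀ ↦ m`. [folklore] -/
theorem exists_addEquiv_zmod_of_cyclic {g : A} (hg : ∀ x : A, x ∈ AddSubgroup.zmultiples g) {m : ℕ} [NeZero m]
    (hcard : Fintype.card A = 2 * m) (hc₀ : c₀ ≠ 0) (h2c : c₀ + c₀ = 0) :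
    ∃ φ : A ≃+ ZMod (2 * m), φ c₀ = (m : ZMod (2 * m)) := by
  haveI : NeZero (2 * m) := ⟨by have := NeZero.ne m; omega⟩
  -- `ψ : ZMod (2m) →+ A`, `k ↦ k • g`
  let ψ : ZMod (2 * m) →+ A := ZMod.lift (2 * m) ⟨zmultiplesHom A g, by
    show ((2 * m : ℕ) : ℤ) • g = 0
    rw [natCast_zsmul, ← hcard]; exact card_nsmul_eq_zero⟩
  have hψ : ∀ k : ℤ, ψ (k : ZMod (2 * m)) = k • g := fun k => by
    show ZMod.lift (2 * m) _ (k : ZMod (2 * m)) = _; rw [ZMod.lift_coe]; rfl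
  have hsurj : Function.Surjective ψ := by
    intro x
    obtain ⟨k, hk⟩ := AddSubgroup.mem_zmultiples_iff.1 (hg x)
    exact ⟨(k : ZMod (2 * m)), by rw [hψ, hk]⟩
  have hbij : Function.Bijective ψ :=
    (Fintype.bijective_iff_surjective_and_card _).2 ⟨hsurj, by rw [ZMod.card, hcard]⟩
  let e : ZMod (2 * m) ≃+ A := AddEquiv.ofBijective ψ hbij
  refine ⟨e.symm, ?_⟩
  have hx : e.symm c₀ ≠ 0 := fun h => hc₀ (by rw [← e.apply_symm_apply c₀, h, map_zero])
  have h2 : e.symm c₀ + e.symm c₀ = 0 := by rw [← map_add, h2c, map_zero]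
  exact ZMod.eq_half_of_add_self hx h2

/-- **Non-cyclic case.** If `A = ⟨g⟩ ∪ (c₀ + ⟨g⟩)` with `c₀ ∉ ⟨g⟩` (`c₀ + c₀ = 0`), then `m := ord g = |A|/2` and
`A ≃+ ℤ₂ × ℤ_m` with `c₀ ↦ (1, 0)`. [folklore] -/
theorem exists_addEquiv_prod_of_not_mem {g : A}
    (hg : ∀ x : A, x ∈ AddSubgroup.zmultiples g ∨ x + c₀ ∈ AddSubgroup.zmultiples g)
    (hc : c₀ ∉ AddSubgroup.zmultiples g) (h2c : c₀ + c₀ = 0) :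
    ∃ φ : A ≃+ ZMod 2 × ZMod (addOrderOf g), φ c₀ = ((1 : ZMod 2), 0) ∧
      Fintype.card A = 2 * addOrderOf g := by
  set m := addOrderOf g with hm
  haveI : NeZero m := ⟨(addOrderOf_pos g).ne'⟩
  -- the two cosets `⟨g⟩`, `c₀ + ⟨g⟩` are disjoint of size `m` each: `2m ≤ |A|`
  have h2m : 2 * m ≤ Fintype.card A := by
    classical
    set S₁ : Finset A := univ.filter fun x => x ∈ AddSubgroup.zmultiples g with hS₁
    have cS₁ : S₁.card = m := by
      rw [hS₁, ← Fintype.card_subtype, hm]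
      convert Fintype.card_zmultiples (x := g)
    have hdisj : Disjoint S₁ (S₁.image (· + c₀)) := by
      rw [disjoint_left]
      rintro x hx hx'
      obtain ⟨y, hy, rfl⟩ := mem_image.1 hx'
      have hy' : y ∈ AddSubgroup.zmultiples g := (mem_filter.1 hy).2
      have hyc : y + c₀ ∈ AddSubgroup.zmultiples g := (mem_filter.1 hx).2
      exact hc (by simpa using (AddSubgroup.zmultiples g).sub_mem hyc hy')
    have := card_le_univ (S₁ ∪ S₁.image (· + c₀))
    rwa [card_union_of_disjoint hdisj, card_image_of_injective _ (add_left_injective c₀), cS₁, ← two_mul] at this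
  -- `ψ : ZMod 2 × ZMod m →+ A`, `(i, j) ↦ i • c₀ + j • g`
  let ψ₁ : ZMod 2 →+ A := ZMod.lift 2 ⟨zmultiplesHom A c₀, by
    show ((2 : ℕ) : ℤ) • c₀ = 0; rw [natCast_zsmul, two_nsmul, h2c]⟩
  let ψ₂ : ZMod m →+ A := ZMod.lift m ⟨zmultiplesHom A g, by
    show ((m : ℕ) : ℤ) • g = 0; rw [natCast_zsmul, hm]; exact addOrderOf_nsmul_eq_zero g⟩
  let ψ : ZMod 2 × ZMod m →+ A := ψ₁.comp (AddMonoidHom.fst _ _) + ψ₂.comp (AddMonoidHom.snd _ _)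
  have hψ₁ : ∀ k : ℤ, ψ₁ (k : ZMod 2) = k • c₀ := fun k => by
    show ZMod.lift 2 _ (k : ZMod 2) = _; rw [ZMod.lift_coe]; rfl
  have hψ₂ : ∀ k : ℤ, ψ₂ (k : ZMod m) = k • g := fun k => by
    show ZMod.lift m _ (k : ZMod m) = _; rw [ZMod.lift_coe]; rfl
  have hψ : ∀ i : ZMod 2, ∀ j : ZMod m, ψ (i, j) = ψ₁ i + ψ₂ j := fun i j => rfl
  have hsurj : Function.Surjective ψ := by
    intro x
    rcases hg x with hx | hx
    · obtain ⟨k, hk⟩ := AddSubgroup.mem_zmultiples_iff.1 hx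
      exact ⟨(((0 : ℤ) : ZMod 2), (k : ZMod m)), by rw [hψ, hψ₁, hψ₂, zero_zsmul, zero_add, hk]⟩
    · obtain ⟨k, hk⟩ := AddSubgroup.mem_zmultiples_iff.1 hx
      refine ⟨(((1 : ℤ) : ZMod 2), (k : ZMod m)), ?_⟩
      rw [hψ, hψ₁, hψ₂, one_zsmul, hk, add_comm c₀, add_assoc, h2c, add_zero]
  have hcardle : Fintype.card A ≤ 2 * m := by
    have := Fintype.card_le_of_surjective ψ hsurj
    rwa [Fintype.card_prod, ZMod.card, ZMod.card] at this
  have hcard : Fintype.card A = 2 * m := le_antisymm hcardle h2m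
  have hbij : Function.Bijective ψ :=
    (Fintype.bijective_iff_surjective_and_card _).2 ⟨hsurj, by rw [Fintype.card_prod, ZMod.card, ZMod.card, hcard]⟩
  let e : ZMod 2 × ZMod m ≃+ A := AddEquiv.ofBijective ψ hbij
  refine ⟨e.symm, ?_, hcard⟩
  apply e.injective
  rw [e.apply_symm_apply]
  show c₀ = ψ (1, 0)
  rw [hψ, map_zero, add_zero, show (1 : ZMod 2) = ((1 : ℤ) : ZMod 2) by rw [Int.cast_one], hψ₁, one_zsmul]

end Structure

/-! ## The classification -/

section Classification

variable {A : Type} [AddCommGroup A] [DecidableEq A] [Fintype A] {G : Type} [Group G] [DecidableEq G]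
  {ρ τ : A → G} {c₀ : A}

/-- **⟸: `A = ⟨g⟩ ∪ (c₀ + ⟨g⟩)` ⇒ the mod-one law is attained** (`c₀ ≠ 0`, `|A| ≡ 1 (mod 3)`, `|A| ≥ 14`). [folklore] -/
theorem mod_one_law_attained_of_quot_cyclic
    (hρρ : ∀ a b, ρ a * ρ b = ρ (a + b)) (hρτ : ∀ a b, ρ a * τ b = τ (b - a))
    (hτρ : ∀ a b, τ a * ρ b = τ (a + b)) (hττ : ∀ a b, τ a * τ b = ρ (c₀ + b - a)) (hc₀ : c₀ ≠ 0)
    (hρ : Function.Injective ρ) (hτ : Function.Injective τ) (hne : ∀ a b, ρ a ≠ τ b)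
    (hsurj : ∀ g, (∃ a, ρ a = g) ∨ (∃ a, τ a = g)) (hmod : Fintype.card A % 3 = 1) (hA : 14 ≤ Fintype.card A)
    {g : A} (hg : ∀ x : A, x ∈ AddSubgroup.zmultiples g ∨ x + c₀ ∈ AddSubgroup.zmultiples g) :
    ∃ S T U : Finset G, TripleProductProperty S T U ∧ 3 * (S.card * T.card * U.card) + 8 = 8 * Fintype.card A := by
  have h2c : c₀ + c₀ = 0 := two_c0_eq_zero hρτ hτρ hττ hτ
  haveI : Fact (c₀ + c₀ = 0) := ⟨h2c⟩
  -- the model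
  let eG : DihedralLikeGroup A c₀ ≃* G :=
    DihedralLikeGroup.equivOfPresentation hρρ hρτ hτρ hττ hρ hτ hne hsurj
  by_cases hc : c₀ ∈ AddSubgroup.zmultiples g
  · -- cyclic case: `A = ⟨g⟩`, `A ≃+ ℤ_{2m}`, `c₀ ↦ m`: the group is `Q_{4m}`
    have hcyc : ∀ x : A, x ∈ AddSubgroup.zmultiples g := cyclic_of_quot_cyclic_of_double (a := c₀) (c₀ := c₀ + c₀)
      rfl (by rw [h2c, add_zero]) (fun x => by
        rcases hg x with hx | hx
        · exact Or.inl hx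
        · right; rw [← add_assoc]; exact (AddSubgroup.zmultiples g).add_mem hx hc)
    -- `|A|` is even
    have hord : addOrderOf c₀ = 2 := addOrderOf_eq_prime (by rw [two_nsmul, h2c]) hc₀
    have h2N : 2 ∣ Fintype.card A := by rw [← hord]; exact addOrderOf_dvd_card
    set m := Fintype.card A / 2 with hm
    have hcard : Fintype.card A = 2 * m := by omega
    haveI : NeZero m := ⟨by omega⟩
    obtain ⟨φ, hφ⟩ := exists_addEquiv_zmod_of_cyclic hcyc hcard hc₀ h2c
    let e := (DihedralLikeGroup.congr (c₀ := c₀) (c₀' := (m : ZMod (2 * m))) φ hφ).symm.trans eG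
    obtain ⟨S, T, U, h, hV⟩ := quaternionModel_mod_one_law_attained (m := m) (by omega) (by omega)
    obtain ⟨S', T', U', h', hV'⟩ := exists_tpp_volume_of_mulEquiv e ⟨S, T, U, h, rfl⟩
    refine ⟨S', T', U', h', ?_⟩
    rw [hV', hcard]; rw [ZMod.card] at hV; exact hV
  · -- non-cyclic case: `A ≃+ ℤ₂ × ℤ_m`, `c₀ ↦ (1,0)`: the group is `ℤ_m ⋊ ℤ₄`
    obtain ⟨φ, hφ, hcard⟩ := exists_addEquiv_prod_of_not_mem hg hc h2c
    haveI : NeZero (addOrderOf g) := ⟨(addOrderOf_pos g).ne'⟩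
    let e := (DihedralLikeGroup.congr (c₀ := c₀) (c₀' := ((1 : ZMod 2), (0 : ZMod (addOrderOf g)))) φ hφ).symm.trans
      eG
    obtain ⟨S, T, U, h, hV⟩ := z2zn_mod_one_law_attained (n := addOrderOf g) (ε := 1) (by omega) (by omega)
    obtain ⟨S', T', U', h', hV'⟩ := exists_tpp_volume_of_mulEquiv e ⟨S, T, U, h, rfl⟩
    refine ⟨S', T', U', h', ?_⟩
    rw [hV', hcard]; rw [Fintype.card_prod, ZMod.card, ZMod.card] at hV; exact hV

/-- **THE DICYCLIC-TYPE LAW CLASSIFICATION.**  Dihedral-like `G(A, c₀)` with `c₀ ≠ 0`, `|A| ≡ 1 (mod 3)`, `|A| ≥ 14`: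
a TPP triple attains `3|S||T||U| + 8 = 8|A|` **iff** `A = ⟨g⟩ ∪ (c₀ + ⟨g⟩)` for some `g` (`A/⟨c₀⟩` cyclic).  The attaining
groups are exactly `Q_{4m}` (`A` cyclic) and `ℤ_m ⋊ ℤ₄` (`A = ℤ₂ × ℤ_m`, `c₀` outside the `ℤ_m`); e.g. `C₂ × Q_{2n}` with
`4 ∣ n` never attains (`no_mod_one_law_Z2_Zn_half`). [folklore] -/
theorem dicyclic_type_mod_one_law_iff
    (hρρ : ∀ a b, ρ a * ρ b = ρ (a + b)) (hρτ : ∀ a b, ρ a * τ b = τ (b - a))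
    (hτρ : ∀ a b, τ a * ρ b = τ (a + b)) (hττ : ∀ a b, τ a * τ b = ρ (c₀ + b - a)) (hc₀ : c₀ ≠ 0)
    (hρ : Function.Injective ρ) (hτ : Function.Injective τ) (hne : ∀ a b, ρ a ≠ τ b)
    (hsurj : ∀ g, (∃ a, ρ a = g) ∨ (∃ a, τ a = g)) (hmod : Fintype.card A % 3 = 1) (hA : 14 ≤ Fintype.card A) :
    (∃ S T U : Finset G, TripleProductProperty S T U ∧ 3 * (S.card * T.card * U.card) + 8 = 8 * Fintype.card A) ↔
      ∃ g : A, ∀ x : A, x ∈ AddSubgroup.zmultiples g ∨ x + c₀ ∈ AddSubgroup.zmultiples g := by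
  constructor
  · rintro ⟨S, T, U, h, hV⟩
    exact quot_cyclic_of_mod_one_law_of_c0_ne_zero hρρ hρτ hτρ hττ hc₀ hρ hτ hne hsurj hmod hA h hV
  · rintro ⟨g, hg⟩
    exact mod_one_law_attained_of_quot_cyclic hρρ hρτ hτρ hττ hc₀ hρ hτ hne hsurj hmod hA hg

end Classification

end Summit.MatrixMultiplication.OmegaCensus
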